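import Literature.AlgebraicGeometry.Motives.TheoremOfCubeThickenings
import Literature.AlgebraicGeometry.Motives.PushforwardStructureSheaf
import Literature.AlgebraicGeometry.Morphisms.FormalFunctions
import HarnessLib

/-!
# The infinitesimal neighbourhoods `X_n = P ×_K Spec(𝒪_{T,t}/𝔪^{n+1})` of a fibre: transition
# maps and global functions `H⁰(X_n, 𝒪_{X_n}) = 𝒪_{T,t}/𝔪^{n+1}`

`Motives/TheoremOfCubeThickenings` defines the `K`-schemes `thickeningPt T t n = Spec(𝒪_{T,t}/𝔪_t^{n+1})`
over a point `t` of a `K`-scheme `T` (with `thickeningPtι T t n : thickeningPt T t n → T`), so that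
for a `K`-scheme `P` the product `P ⊗ thickeningPt T t n` is an infinitesimal neighbourhood of
the fibre of `X = P ×_K T → S = T` over `s = t` (Görtz–Wedhorn II, Thm. 24.42, Lemma 24.72
Step (II)). INDEXING CONVENTION (here and in the sequel `Motives/TheoremOfCubeFormalLift`): we write
`X_n` for `P ⊗ thickeningPt T t n = P ×_K Spec(𝒪_{T,t}/𝔪^{n+1})`, which is Görtz–Wedhorn's
`X_{n+1} := X ×_S Spec(𝒪_{S,s}/𝔪_s^{n+1})`; so our `X_0` is the fibre `X_s` (up to the isomorphism
`𝒪/𝔪^1 ≅ κ(s)`) and our tower `X_0 ↪ X_1 ↪ ⋯ → X` is theirs. This file adds what Step (II) of the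
proof of Lemma 24.72 uses about this tower, all PROVED:

* `stalkModPow T t n = 𝒪_{T,t}/𝔪^{n+1}` (as an object of `CommRingCat`, so that
  `(thickeningPt T t n).left = Spec (stalkModPow T t n)`), the quotient maps
  `stalkModPowTransitionHom : 𝒪/𝔪^{n+2} → 𝒪/𝔪^{n+1}` (the tree's
  `Morphisms.infinitesimalNeighbourhood.transitionRingHom` of `Morphisms/FormalFunctions` at
  `I = 𝔪_t`) and the induced transition maps
  `thickeningPtTransition T t n : thickeningPt T t n → thickeningPt T t (n + 1)` over `T`
  (`thickeningPtTransition_comp`), whence compatible structure maps `X_n → X_{n+1} → P ×_K T`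
  (`whiskerLeft_thickeningPtTransition_comp_left`); every point of `X_n` lies over `t`
  (`snd_left_whiskerLeft_thickeningPtι_apply`); `X_n ≠ ∅` (`nonempty_thickening_left`);
* **(∗) `H⁰(X_n, 𝒪_{X_n}) = 𝒪_{T,t}/𝔪^{n+1}`** for `P` proper and geometrically integral
  (Görtz–Wedhorn II, Cor. 24.63, "`H⁰(X_A, 𝒪_{X_A}) = A`" in the proof of Lemma 24.72): the ring
  isomorphism `thickeningFunEquiv : 𝒪_{T,t}/𝔪^{n+1} ≃+* Γ(X_n, 𝒪)`, `a ↦ pr^*(a)`, from the tree's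
  discharge `snd_app_bijective_holds` of Cor. 24.63 (`Motives/PushforwardStructureSheaf`) and
  Mathlib's `ΓSpecIso`; naturality in `n` (`appTop_transition_thickeningFun`);
* consequences for the restriction of functions `Γ(X_{n+1}, 𝒪) → Γ(X_n, 𝒪)` along the transition
  map: it is surjective (`appTop_transition_surjective`) and detects units
  (`isUnit_of_isUnit_appTop_transition`: `𝒪/𝔪^{n+2} → 𝒪/𝔪^{n+1}` is a surjection of local rings;
  `exists_unit_appTop_transition_eq`) — the two facts behind "compatible trivialising sections can
  be chosen on all `X_n`" for a line bundle trivial on each `X_n` (any lift of a unit is a unit).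

Relation to `Morphisms/FormalFunctions` (`infinitesimalNeighbourhood I f n = X ×_A A/I^{n+1}` for an
AFFINE base `f : X → Spec A` and a global ideal `I`, with `transition`, `restrict`,
`formalFunctions_H0` = Stacks 02OC for `𝓕 = 𝒪_X`): the present tower lives over the non-affine
`K`-scheme `T` and is built from the stalk `𝒪_{T,t}` (Görtz–Wedhorn's Thm. 24.42 rather than
Thm. 24.37), as `K`-schemes `P ⊗ thickeningPt T t n` so that the divisor calculus on `P ×_K T`
applies verbatim; the ring-level maps are shared (`transitionRingHom`). Mathlib searched (pin):
`Scheme.ΓSpecIso`, `ΓSpecIso_inv_naturality`, `Scheme.Hom.comp_appTop`,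
`CartesianMonoidalCategory.whiskerLeft_snd`, `Over.comp_left`, `Ideal.Quotient.factor`,
`Ideal.Quotient.nontrivial_iff`, `IsLocalHom.of_surjective`, `isUnit_of_map_unit` (used).

## References

* U. Görtz, T. Wedhorn, *Algebraic Geometry II: Cohomology of Schemes*, Springer Spektrum (2023),
  doi:10.1007/978-3-658-43031-3: Thm. 24.42, p. 529; Cor. 24.63, p. 539; Lemma 24.72, proof,
  (∗) and Step (II), pp. 548–549 (read via the held copy). [GortzWedhorn2023]
-/

universe u

open CategoryTheory CategoryTheory.Limits AlgebraicGeometry MonoidalCategory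
open CartesianMonoidalCategory

noncomputable section

namespace Literature.AlgebraicGeometry.Motives

variable {K : Type u} [Field K]

/-! ### Units of a local ring modulo an ideal inside the maximal ideal -/

/-- In a local ring, an element which is a unit modulo an ideal contained in the maximal ideal is a
unit. [folklore] -/
theorem isUnit_of_isUnit_mk_of_le_maximalIdeal {R : Type u} [CommRing R] [IsLocalRing R]
    {I : Ideal R} (hI : I ≤ IsLocalRing.maximalIdeal R) {r : R}
    (h : IsUnit (Ideal.Quotient.mk I r)) : IsUnit r := by
  haveI : Nontrivial (R ⧸ I) := Ideal.Quotient.nontrivial_iff.2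
    (ne_top_of_le_ne_top (IsLocalRing.maximalIdeal.isMaximal R).ne_top hI)
  haveI := IsLocalHom.of_surjective (Ideal.Quotient.mk I) Ideal.Quotient.mk_surjective
  exact isUnit_of_map_unit (Ideal.Quotient.mk I) r h

/-! ### The rings `𝒪_{T,t}/𝔪^{n+1}` and the transition maps of the thickenings -/

section Transition

variable (T : SchemeOver K) (t : T.left)

/-- The ring `𝒪_{T,t}/𝔪_t^{n+1}` (so that `(thickeningPt T t n).left = Spec (stalkModPow T t n)`).
[folklore] -/
def stalkModPow (n : ℕ) : CommRingCat.{u} :=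
  CommRingCat.of (↑(T.left.presheaf.stalk t) ⧸
    IsLocalRing.maximalIdeal (T.left.presheaf.stalk t) ^ (n + 1))

/-- The quotient map `𝒪_{T,t} → 𝒪_{T,t}/𝔪^{n+1}`. [folklore] -/
def stalkModPowMk (n : ℕ) : T.left.presheaf.stalk t ⟶ stalkModPow T t n :=
  CommRingCat.ofHom (Ideal.Quotient.mk _)

/-- `thickeningPt T t n` is `Spec(𝒪_{T,t}/𝔪^{n+1})` with structure morphism through
`Spec 𝒪_{T,t} → T`. [folklore] -/
theorem thickeningPt_hom_eq (n : ℕ) :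
    (thickeningPt T t n).hom = Spec.map (stalkModPowMk T t n) ≫ T.left.fromSpecStalk t ≫ T.hom :=
  rfl

/-- The morphism `thickeningPtι T t n : Spec(𝒪_{T,t}/𝔪^{n+1}) → T`, folded. [folklore] -/
theorem thickeningPtι_left_eq (n : ℕ) :
    (thickeningPtι T t n).left = Spec.map (stalkModPowMk T t n) ≫ T.left.fromSpecStalk t := rfl

/-- The quotient map `𝒪_{T,t}/𝔪^{n+2} → 𝒪_{T,t}/𝔪^{n+1}` (as a ring homomorphism): the tree's
`Morphisms.infinitesimalNeighbourhood.transitionRingHom` (`Morphisms/FormalFunctions`) for the ideal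
`𝔪_t ⊆ 𝒪_{T,t}`. [folklore] -/
abbrev stalkModPowTransitionHom (n : ℕ) : ↑(stalkModPow T t (n + 1)) →+* ↑(stalkModPow T t n) :=
  Morphisms.infinitesimalNeighbourhood.transitionRingHom
    (IsLocalRing.maximalIdeal (T.left.presheaf.stalk t)) n

/-- `stalkModPowTransitionHom` on residue classes. [folklore] -/
@[simp] theorem stalkModPowTransitionHom_mk (n : ℕ) (r : T.left.presheaf.stalk t) :
    stalkModPowTransitionHom T t n (Ideal.Quotient.mk _ r) = Ideal.Quotient.mk _ r := rfl

/-- `stalkModPowTransitionHom` is surjective. [folklore] -/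
theorem stalkModPowTransitionHom_surjective (n : ℕ) :
    Function.Surjective (stalkModPowTransitionHom T t n) :=
  Ideal.Quotient.factor_surjective (Ideal.pow_le_pow_right (Nat.le_succ _))

/-- The quotient map `𝒪_{T,t}/𝔪^{n+2} → 𝒪_{T,t}/𝔪^{n+1}` in `CommRingCat`. [folklore] -/
def stalkModPowTransition (n : ℕ) : stalkModPow T t (n + 1) ⟶ stalkModPow T t n :=
  CommRingCat.ofHom (stalkModPowTransitionHom T t n)

/-- `𝒪 → 𝒪/𝔪^{n+2} → 𝒪/𝔪^{n+1}` is `𝒪 → 𝒪/𝔪^{n+1}`. [folklore] -/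
@[simp] theorem stalkModPowMk_comp_transition (n : ℕ) :
    stalkModPowMk T t (n + 1) ≫ stalkModPowTransition T t n = stalkModPowMk T t n :=
  CommRingCat.hom_ext (RingHom.ext fun _ => rfl)

/-- `Spec(𝒪/𝔪^{n+1}) → Spec(𝒪/𝔪^{n+2}) → Spec 𝒪_{T,t}` is `Spec(𝒪/𝔪^{n+1}) → Spec 𝒪_{T,t}`. [folklore] -/
theorem Spec_map_transition_comp (n : ℕ) {Z : Scheme.{u}} (h : Spec (T.left.presheaf.stalk t) ⟶ Z) :
    Spec.map (stalkModPowTransition T t n) ≫ Spec.map (stalkModPowMk T t (n + 1)) ≫ h =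
      Spec.map (stalkModPowMk T t n) ≫ h := by
  rw [← Spec.map_comp_assoc, stalkModPowMk_comp_transition]

/-- **The transition map `thickeningPt T t n → thickeningPt T t (n + 1)`** of `K`-schemes
(`Spec(𝒪_{T,t}/𝔪^{n+1}) ↪ Spec(𝒪_{T,t}/𝔪^{n+2})`), inducing the closed immersions
`X_n ↪ X_{n+1}` of the infinitesimal neighbourhoods of a fibre of `P ×_K T → T` (indexing as in
the module docstring; Görtz–Wedhorn II, Thm. 24.42: the inverse system `(H^p(X_n, 𝓕_n))_n`).
[folklore] -/
def thickeningPtTransition (n : ℕ) : thickeningPt T t n ⟶ thickeningPt T t (n + 1) :=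
  Over.homMk (Spec.map (stalkModPowTransition T t n))
    (Spec_map_transition_comp T t n (T.left.fromSpecStalk t ≫ T.hom))

/-- The scheme morphism underlying the transition map. [folklore] -/
@[simp] theorem thickeningPtTransition_left (n : ℕ) :
    (thickeningPtTransition T t n).left = Spec.map (stalkModPowTransition T t n) := rfl

/-- The transition maps are morphisms over `T`. [folklore] -/
@[simp] theorem thickeningPtTransition_comp (n : ℕ) :
    thickeningPtTransition T t n ≫ thickeningPtι T t (n + 1) = thickeningPtι T t n := by
  ext : 1
  exact Spec_map_transition_comp T t n (T.left.fromSpecStalk t)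

variable (P : SchemeOver K)

/-- The structure maps `X_n → P ×_K T` of the infinitesimal neighbourhoods are compatible with the
transition maps `X_n ↪ X_{n+1}`. [folklore] -/
theorem whiskerLeft_thickeningPtTransition_comp (n : ℕ) :
    (P ◁ thickeningPtTransition T t n) ≫ (P ◁ thickeningPtι T t (n + 1)) =
      P ◁ thickeningPtι T t n := by
  rw [← MonoidalCategory.whiskerLeft_comp, thickeningPtTransition_comp]

/-- The same compatibility for the underlying scheme morphisms. [folklore] -/
theorem whiskerLeft_thickeningPtTransition_comp_left (n : ℕ) :
    (P ◁ thickeningPtTransition T t n).left ≫ (P ◁ thickeningPtι T t (n + 1)).left =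
      (P ◁ thickeningPtι T t n).left := by
  rw [← Over.comp_left, whiskerLeft_thickeningPtTransition_comp]

/-- Every point of `X_n = P ×_K Spec(𝒪_{T,t}/𝔪^{n+1})` lies over `t` under `P ×_K T → T`.
[folklore] -/
theorem snd_left_whiskerLeft_thickeningPtι_apply (n : ℕ) (x : (P ⊗ thickeningPt T t n).left) :
    (snd P T).left ((P ◁ thickeningPtι T t n).left x) = t := by
  have e : (P ◁ thickeningPtι T t n) ≫ snd P T =
      snd P (thickeningPt T t n) ≫ thickeningPtι T t n := by simp
  rw [← Scheme.Hom.comp_apply, ← Over.comp_left, e, Over.comp_left, Scheme.Hom.comp_apply]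
  exact thickeningPtι_left_apply T t n _

/-- `𝒪_{T,t}/𝔪^{n+1}` is not the zero ring. [folklore] -/
instance nontrivial_stalkModPow (n : ℕ) : Nontrivial (stalkModPow T t n) :=
  Ideal.Quotient.nontrivial_iff.2 (ne_top_of_le_ne_top
    (IsLocalRing.maximalIdeal.isMaximal _).ne_top (Ideal.pow_le_self (Nat.succ_ne_zero n)))

/-- `X_n = P ×_K Spec(𝒪_{T,t}/𝔪^{n+1})` is non-empty as soon as `P → Spec K` is surjective (e.g. `P`
geometrically integral). [folklore] -/
theorem nonempty_thickening_left [Surjective P.hom] (n : ℕ) :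
    Nonempty (P ⊗ thickeningPt T t n).left := by
  obtain ⟨x, -⟩ := (snd P (thickeningPt T t n)).left.surjective
    (show (thickeningPt T t n).left from Classical.arbitrary (PrimeSpectrum (stalkModPow T t n)))
  exact ⟨x⟩

end Transition

/-! ### `H⁰(X_n, 𝒪_{X_n}) = 𝒪_{T,t}/𝔪^{n+1}` (Görtz–Wedhorn II, Cor. 24.63) -/

section GlobalFunctions

variable (T : SchemeOver K) (t : T.left) (P : SchemeOver K)

/-- The ring homomorphism `𝒪_{T,t}/𝔪^{n+1} → Γ(X_n, 𝒪_{X_n})`, `a ↦ pr^*(a)`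
(`X_n = P ×_K Spec(𝒪_{T,t}/𝔪^{n+1})`, `pr` its second projection; Mathlib's `ΓSpecIso` identifies
`Γ(Spec A, 𝒪)` with `A`), as a morphism of `CommRingCat`. [folklore] -/
def thickeningFunHom (n : ℕ) : stalkModPow T t n ⟶ Γ((P ⊗ thickeningPt T t n).left, ⊤) :=
  (Scheme.ΓSpecIso (stalkModPow T t n)).inv ≫ (snd P (thickeningPt T t n)).left.appTop

/-- The ring homomorphism `𝒪_{T,t}/𝔪^{n+1} → Γ(X_n, 𝒪_{X_n})`, `a ↦ pr^*(a)`. [folklore] -/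
abbrev thickeningFun (n : ℕ) : ↑(stalkModPow T t n) →+* Γ((P ⊗ thickeningPt T t n).left, ⊤) :=
  (thickeningFunHom T t P n).hom

/-- **(∗) `H⁰(X_n, 𝒪_{X_n}) = 𝒪_{T,t}/𝔪^{n+1}`**: `a ↦ pr^*(a)` is bijective for `P` proper and
geometrically integral over `K` (Görtz–Wedhorn II, Cor. 24.63 for the flat proper morphism
`X_n → Spec(𝒪_{T,t}/𝔪^{n+1})` with geometrically integral fibres — "(∗) `H⁰(X_A, 𝒪_{X_A}) = A`" in
the proof of Lemma 24.72; here from the tree's `snd_app_bijective_holds`).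
[cite: GortzWedhorn2023, Cor. 24.63 (p. 539) and Lemma 24.72, proof, (∗) (p. 548)] -/
theorem thickeningFun_bijective [IsProper P.hom] [GeometricallyIntegral P.hom] (n : ℕ) :
    Function.Bijective (thickeningFun T t P n) :=
  (snd_app_bijective_holds K P (thickeningPt T t n) ⊤).comp
    (ConcreteCategory.bijective_of_isIso (Scheme.ΓSpecIso (stalkModPow T t n)).inv)

/-- **`𝒪_{T,t}/𝔪^{n+1} ≃+* H⁰(X_n, 𝒪_{X_n})`** for `P` proper and geometrically integral
(`thickeningFun_bijective`). [cite: GortzWedhorn2023, Cor. 24.63 (p. 539)] -/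
def thickeningFunEquiv [IsProper P.hom] [GeometricallyIntegral P.hom] (n : ℕ) :
    ↑(stalkModPow T t n) ≃+* Γ((P ⊗ thickeningPt T t n).left, ⊤) :=
  RingEquiv.ofBijective (thickeningFun T t P n) (thickeningFun_bijective T t P n)

/-- `thickeningFunEquiv` is `thickeningFun`. [folklore] -/
@[simp] theorem thickeningFunEquiv_apply [IsProper P.hom] [GeometricallyIntegral P.hom] (n : ℕ)
    (a : stalkModPow T t n) : thickeningFunEquiv T t P n a = thickeningFun T t P n a := rfl

/-- **Naturality of (∗) in `n`**: restricting `pr^*(a)` from `X_{n+1}` to `X_n` gives `pr^*(ā)`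
with `ā` the image of `a` in `𝒪_{T,t}/𝔪^{n+1}`. [folklore] -/
theorem appTop_transition_thickeningFun (n : ℕ) (a : stalkModPow T t (n + 1)) :
    (P ◁ thickeningPtTransition T t n).left.appTop (thickeningFun T t P (n + 1) a) =
      thickeningFun T t P n (stalkModPowTransitionHom T t n a) := by
  have e : (P ◁ thickeningPtTransition T t n).left ≫ (snd P (thickeningPt T t (n + 1))).left =
      (snd P (thickeningPt T t n)).left ≫ (thickeningPtTransition T t n).left := by
    rw [← Over.comp_left, ← Over.comp_left, whiskerLeft_snd]
  -- `pr ∘ (X_n → X_{n+1}) = (Spec(𝒪/𝔪^{n+1}) → Spec(𝒪/𝔪^{n+2})) ∘ pr` on functions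
  have h1 : ∀ y, (P ◁ thickeningPtTransition T t n).left.appTop
      ((snd P (thickeningPt T t (n + 1))).left.appTop y) =
      (snd P (thickeningPt T t n)).left.appTop ((Spec.map (stalkModPowTransition T t n)).appTop y) :=
    fun y => congrArg (fun f : (P ⊗ thickeningPt T t n).left ⟶ (thickeningPt T t (n + 1)).left =>
      f.appTop y) e
  -- `ΓSpecIso` is natural
  have h2 : (Spec.map (stalkModPowTransition T t n)).appTop
      ((Scheme.ΓSpecIso (stalkModPow T t (n + 1))).inv a) =
      (Scheme.ΓSpecIso (stalkModPow T t n)).inv (stalkModPowTransitionHom T t n a) :=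
    (congrArg (fun φ : stalkModPow T t (n + 1) ⟶ Γ(Spec (stalkModPow T t n), ⊤) => φ a)
      (Scheme.ΓSpecIso_inv_naturality (stalkModPowTransition T t n))).symm
  exact (h1 _).trans (congrArg _ h2)

variable [IsProper P.hom] [GeometricallyIntegral P.hom]

/-- **Functions on `X_n` extend to `X_{n+1}`**: the restriction `Γ(X_{n+1}, 𝒪) → Γ(X_n, 𝒪)` along
the transition map is surjective (it is `𝒪/𝔪^{n+2} → 𝒪/𝔪^{n+1}` under (∗)). [folklore] -/
theorem appTop_transition_surjective (n : ℕ) :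
    Function.Surjective (P ◁ thickeningPtTransition T t n).left.appTop := by
  intro b
  obtain ⟨b, rfl⟩ := (thickeningFun_bijective T t P n).2 b
  obtain ⟨a, rfl⟩ := stalkModPowTransitionHom_surjective T t n b
  exact ⟨thickeningFun T t P (n + 1) a, appTop_transition_thickeningFun T t P n a⟩

/-- **A function on `X_{n+1}` whose restriction to `X_n` is a unit is a unit** (under (∗) this is:
an element of the local ring `𝒪/𝔪^{n+2}` which is a unit modulo `𝔪^{n+1}/𝔪^{n+2}` is a unit). So any
lift of a unit of `Γ(X_n, 𝒪)` to `Γ(X_{n+1}, 𝒪)` is a unit. [folklore] -/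
theorem isUnit_of_isUnit_appTop_transition (n : ℕ) {a : Γ((P ⊗ thickeningPt T t (n + 1)).left, ⊤)}
    (h : IsUnit ((P ◁ thickeningPtTransition T t n).left.appTop a)) : IsUnit a := by
  obtain ⟨a, rfl⟩ := (thickeningFun_bijective T t P (n + 1)).2 a
  obtain ⟨r, rfl⟩ := Ideal.Quotient.mk_surjective a
  rw [appTop_transition_thickeningFun] at h
  -- `r mod 𝔪^{n+1}` is a unit, hence so is `r`
  have h1 : IsUnit (stalkModPowTransitionHom T t n (Ideal.Quotient.mk _ r)) :=
    (isUnit_map_iff (thickeningFunEquiv T t P n) _).1 h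
  rw [stalkModPowTransitionHom_mk] at h1
  exact ((isUnit_of_isUnit_mk_of_le_maximalIdeal (Ideal.pow_le_self (Nat.succ_ne_zero n)) h1).map
    (Ideal.Quotient.mk _)).map _

/-- Units of `Γ(X_n, 𝒪)` lift to units of `Γ(X_{n+1}, 𝒪)`. [folklore] -/
theorem exists_unit_appTop_transition_eq (n : ℕ) (u : Γ((P ⊗ thickeningPt T t n).left, ⊤)ˣ) :
    ∃ v : Γ((P ⊗ thickeningPt T t (n + 1)).left, ⊤)ˣ,
      (P ◁ thickeningPtTransition T t n).left.appTop (v : Γ((P ⊗ thickeningPt T t (n + 1)).left, ⊤)) =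
        u := by
  obtain ⟨a, ha⟩ := appTop_transition_surjective T t P n u
  have hu : IsUnit a := isUnit_of_isUnit_appTop_transition T t P n (by rw [ha]; exact u.isUnit)
  exact ⟨hu.unit, by rw [IsUnit.unit_spec, ha]⟩

end GlobalFunctions

end Literature.AlgebraicGeometry.Motives

end
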